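import Mathlib

/-!
# Tier 3 (T3.2 / T3.5) — the involution `c` on the anticyclotomic side: inversion on the
quotient, `c`-stable kernels and conductor exponents, the anti-diagonal quotient of a pair

Kernel twin of two CELL sentences of proofs/t3-p3/R2-PINNING-ADDENDUM-4.md (t3-p3 g5–g7):

* §A20 (3): «Its conductor is c-STABLE: ν∘c = ν⁻¹ (c acts by inversion on Γ⁻, Z(ℭ)⁻ being the
  quotient by the c-invariant part), cond(ν∘c) = c(cond ν) and cond(ν⁻¹) = cond(ν) — so
  cond(ν) = 𝔓ⁿ𝔓̄ⁿ with the SAME exponent n at 𝔓 and 𝔓̄ (this is why «unramified outside 𝔭»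
  can only mean outside the pair)».
* §A21 (2): «The anticyclotomic quotient of U¹ is ⊕_{𝔮 | p, 𝔮 ⊂ E′⁺} ℤ_p e_𝔮 (the pair
  (x, y) ∈ (1+𝔓𝒪) × (1+𝔓̄𝒪) ↦ x/y)».

Abstract setting: a commutative group `G` (the idèle class group of `E′`, or the ray class group
`Z(ℭ)`), an endomorphism `c : G →* G` (complex conjugation), characters `ν : G →* A`.

1. `Inversion`: when a subgroup `H` contains every «norm» `y * c y` — the `c`-invariants do, for an
   involution `c` — the class of `c x` in `G ⧸ H` is the inverse of the class of `x`
   (`mk_map_eq_inv`): `c` acts by inversion on the quotient, so every character of `G ⧸ H`, pulled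
   back to `G`, satisfies `ν (c x) = (ν x)⁻¹` (`comp_mk_map_eq_inv`, `map_apply_eq_inv_of_norms`);
   conversely such a `ν` kills the norms and is 2-torsion on the `c`-invariants, hence TRIVIAL on
   them when its order is odd (`map_eq_one_of_fixed_of_odd`: a `p`-power-order `ν`, `p` odd, with
   `ν ∘ c = ν⁻¹` factors through the quotient by the `c`-invariant part).
2. `Conductor`: for `ν ∘ c = ν⁻¹`, a subgroup `U` lies in `ker ν` iff its image `U.map c` does
   (`map_le_ker_iff`); the kernel is `c`-stable (`ker_map_eq`); for a filtration `U n` (the units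
   `1 + 𝔓ⁿ𝒪_𝔓`) and its `c`-image (the units `1 + 𝔓̄ⁿ𝒪_𝔓̄`) the set of levels on which `ν` is
   trivial, hence the least such level — the conductor exponent — is the SAME
   (`setOf_map_le_ker_eq`, `sInf_map_le_ker_eq`).
3. `AntiDiagonal`: `(x, y) ↦ x / y` is a surjective homomorphism `A × A →* A` whose kernel is the
   diagonal = the fixed points of the swap (`mem_ker_antiDiag_iff`, `mem_ker_antiDiag_iff_swap`),
   so `(A × A) ⧸ diag ≃* A` (`antiDiagQuotientEquiv`); the swap acts on it by inversion
   (`antiDiag_swap`, `mul_swap_mem_ker_antiDiag`); a character of the quotient is trivial on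
   `U × 1` iff it is trivial on `1 × U` iff `ν` is trivial on `U` (`prod_bot_le_ker_iff`,
   `bot_prod_le_ker_iff`), so its conductor exponents at `𝔓` and `𝔓̄` coincide
   (`sInf_prod_bot_le_ker_eq`); and the product over the places `𝔮 | p` of `E′⁺`
   (`antiDiagPiQuotientEquiv`: `(ι → A × A) ⧸ diag ≃* (ι → A)`).

Imports: Mathlib only; one definition (`antiDiag`, and its product `antiDiagPi`), two
noncomputable equivalences (the quotient isomorphisms), theorems otherwise; no instance; no axiom
beyond the standard three.
-/

namespace Summit.Ventures.HodgeRepro.T3.AnticyclotomicInvolution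

section Inversion

variable {G : Type*} [CommGroup G]

/-- The norms `y * c y` are `c`-invariant when `c` is an involution (`c (c y) = y`): the
`c`-invariant part contains every norm. -/
theorem map_mul_map_self (c : G →* G) (hc : ∀ y, c (c y) = y) (y : G) :
    c (y * c y) = y * c y := by
  rw [map_mul, hc, mul_comm]

/-- Every norm lies in the subgroup of `c`-invariants `eqLocus c id` when `c` is an involution. -/
theorem mul_map_self_mem_eqLocus (c : G →* G) (hc : ∀ y, c (c y) = y) (y : G) :
    y * c y ∈ c.eqLocus (MonoidHom.id G) :=
  map_mul_map_self c hc y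

/-- «c acts by inversion on Γ⁻»: in `G ⧸ H`, when `H` contains every norm `y * c y` (e.g. `H` = the
`c`-invariant part), the class of `c x` is the inverse of the class of `x`. -/
theorem mk_map_eq_inv (c : G →* G) (H : Subgroup G) (hH : ∀ y, y * c y ∈ H) (x : G) :
    (QuotientGroup.mk (c x) : G ⧸ H) = (QuotientGroup.mk x : G ⧸ H)⁻¹ := by
  rw [← QuotientGroup.mk_inv, QuotientGroup.eq_iff_div_mem, div_inv_eq_mul, mul_comm]
  exact hH x

/-- A character of `G ⧸ H` (`H` ⊇ the norms), pulled back to `G`, satisfies `ν (c x) = (ν x)⁻¹`. -/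
theorem comp_mk_map_eq_inv {A : Type*} [Group A] (c : G →* G) (H : Subgroup G)
    (hH : ∀ y, y * c y ∈ H) (ν : G ⧸ H →* A) (x : G) :
    ν (QuotientGroup.mk (c x)) = (ν (QuotientGroup.mk x))⁻¹ := by
  rw [mk_map_eq_inv c H hH, map_inv]

/-- A character of `G` trivial on every norm `y * c y` satisfies `ν ∘ c = ν⁻¹`. -/
theorem map_apply_eq_inv_of_norms {A : Type*} [Group A] (c : G →* G) (ν : G →* A)
    (hν : ∀ y, ν (y * c y) = 1) (x : G) : ν (c x) = (ν x)⁻¹ :=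
  eq_inv_of_mul_eq_one_right (by rw [← map_mul]; exact hν x)

/-- Conversely, `ν ∘ c = ν⁻¹` kills every norm. -/
theorem map_norm_eq_one {A : Type*} [Group A] (c : G →* G) (ν : G →* A)
    (hν : ∀ x, ν (c x) = (ν x)⁻¹) (y : G) : ν (y * c y) = 1 := by
  rw [map_mul, hν, mul_inv_cancel]

/-- `ν ∘ c = ν⁻¹` makes `ν` 2-torsion on the `c`-invariants: `ν x ^ 2 = 1` when `c x = x`. -/
theorem map_sq_eq_one_of_fixed {A : Type*} [Group A] (c : G →* G) (ν : G →* A)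
    (hν : ∀ x, ν (c x) = (ν x)⁻¹) {x : G} (hx : c x = x) : ν x ^ 2 = 1 := by
  have h := hν x
  rw [hx] at h
  rw [sq]
  exact mul_eq_one_iff_eq_inv.mpr h

/-- For `ν` of ODD order `m` (`ν ^ m = 1`; e.g. of `p`-power order with `p` odd, the finite-order
characters `ν ∈ Ξ_𝔭`), `ν ∘ c = ν⁻¹` makes `ν` TRIVIAL on the `c`-invariants: the character factors
through the quotient by the `c`-invariant part — §A20 (3) «Z(ℭ)⁻ being the quotient by the
c-invariant part». -/
theorem map_eq_one_of_fixed_of_odd {A : Type*} [Group A] (c : G →* G) (ν : G →* A)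
    (hν : ∀ x, ν (c x) = (ν x)⁻¹) {m : ℕ} (hm : Odd m) (hνm : ∀ x, ν x ^ m = 1)
    {x : G} (hx : c x = x) : ν x = 1 := by
  have h2 : ν x ^ 2 = 1 := map_sq_eq_one_of_fixed c ν hν hx
  have hg : ν x ^ Nat.gcd 2 m = 1 := pow_gcd_eq_one.mpr ⟨h2, hνm x⟩
  have hg1 : Nat.gcd 2 m = 1 := hm.coprime_two_left
  rwa [hg1, pow_one] at hg

end Inversion

section Conductor

variable {G : Type*} [Group G] {A : Type*} [Group A]

/-- «cond(ν∘c) = c(cond ν) and cond(ν⁻¹) = cond(ν)»: for `ν ∘ c = ν⁻¹`, a subgroup `U` lies in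
`ker ν` iff its image `U.map c` does. (No bijectivity of `c` is needed.) -/
theorem map_le_ker_iff (c : G →* G) (ν : G →* A) (hν : ∀ x, ν (c x) = (ν x)⁻¹)
    (U : Subgroup G) : U.map c ≤ ν.ker ↔ U ≤ ν.ker := by
  constructor
  · intro h u hu
    have h1 := h (Subgroup.mem_map_of_mem c hu)
    rw [MonoidHom.mem_ker, hν, inv_eq_one] at h1
    exact h1
  · rintro h _ ⟨u, hu, rfl⟩
    rw [MonoidHom.mem_ker, hν, inv_eq_one]
    exact h hu

/-- The kernel of such a `ν` is mapped into itself by `c`. -/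
theorem ker_map_le (c : G →* G) (ν : G →* A) (hν : ∀ x, ν (c x) = (ν x)⁻¹) :
    ν.ker.map c ≤ ν.ker :=
  (map_le_ker_iff c ν hν ν.ker).mpr le_rfl

/-- For an involution `c`, the kernel of such a `ν` is `c`-STABLE: `c (ker ν) = ker ν`. -/
theorem ker_map_eq (c : G →* G) (hc : ∀ y, c (c y) = y) (ν : G →* A)
    (hν : ∀ x, ν (c x) = (ν x)⁻¹) : ν.ker.map c = ν.ker := by
  refine le_antisymm (ker_map_le c ν hν) fun x hx => ?_
  show x ∈ ν.ker.map c
  rw [Subgroup.mem_map]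
  refine ⟨c x, ?_, hc x⟩
  show c x ∈ ν.ker
  rw [MonoidHom.mem_ker, hν, inv_eq_one]
  exact hx

/-- Conductor exponents agree: for a filtration `U n` (the units `1 + 𝔓ⁿ𝒪_𝔓`) and its `c`-image
`(U n).map c` (the units `1 + 𝔓̄ⁿ𝒪_𝔓̄`), the set of levels `n` on which `ν` is trivial is the
same. -/
theorem setOf_map_le_ker_eq (c : G →* G) (ν : G →* A) (hν : ∀ x, ν (c x) = (ν x)⁻¹)
    (U : ℕ → Subgroup G) : {n | (U n).map c ≤ ν.ker} = {n | U n ≤ ν.ker} := by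
  ext n
  exact map_le_ker_iff c ν hν (U n)

/-- «cond(ν) = 𝔓ⁿ𝔓̄ⁿ with the SAME exponent n at 𝔓 and 𝔓̄»: the least level on which `ν` is
trivial is the same for the filtration and for its `c`-image. -/
theorem sInf_map_le_ker_eq (c : G →* G) (ν : G →* A) (hν : ∀ x, ν (c x) = (ν x)⁻¹)
    (U : ℕ → Subgroup G) : sInf {n | (U n).map c ≤ ν.ker} = sInf {n | U n ≤ ν.ker} := by
  rw [setOf_map_le_ker_eq c ν hν U]

end Conductor

section AntiDiagonal

variable (A : Type*) [CommGroup A]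

/-- The anticyclotomic map on a pair of local unit groups: `(x, y) ↦ x / y`
(§A21 (2): «the pair (x, y) ∈ (1+𝔓𝒪) × (1+𝔓̄𝒪) ↦ x/y»). -/
def antiDiag : A × A →* A where
  toFun q := q.1 / q.2
  map_one' := by simp
  map_mul' a b := by
    change a.1 * b.1 / (a.2 * b.2) = a.1 / a.2 * (b.1 / b.2)
    exact mul_div_mul_comm _ _ _ _

variable {A}

/-- The defining formula. -/
@[simp] theorem antiDiag_apply (q : A × A) : antiDiag A q = q.1 / q.2 := rfl

/-- The kernel of the anticyclotomic map is the diagonal. -/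
theorem mem_ker_antiDiag_iff (q : A × A) : q ∈ (antiDiag A).ker ↔ q.1 = q.2 := by
  rw [MonoidHom.mem_ker, antiDiag_apply, div_eq_one]

/-- … = the fixed points of the swap (the `c`-invariant part of the pair). -/
theorem mem_ker_antiDiag_iff_swap (q : A × A) : q ∈ (antiDiag A).ker ↔ Prod.swap q = q := by
  rw [mem_ker_antiDiag_iff]
  constructor
  · intro h
    exact Prod.ext h.symm h
  · intro h
    have h1 := congrArg Prod.fst h
    exact h1.symm

/-- The anticyclotomic map is surjective: `x = antiDiag (x, 1)`. -/
theorem antiDiag_surjective : Function.Surjective (antiDiag A) :=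
  fun x => ⟨(x, 1), by simp⟩

/-- «The anticyclotomic quotient of the pair is one copy of the line»: `(A × A) ⧸ diag ≃* A`. -/
noncomputable def antiDiagQuotientEquiv : (A × A) ⧸ (antiDiag A).ker ≃* A :=
  QuotientGroup.quotientKerEquivOfSurjective (antiDiag A) antiDiag_surjective

/-- The swap acts on the anticyclotomic map by inversion: `antiDiag (y, x) = (antiDiag (x, y))⁻¹`. -/
theorem antiDiag_swap (q : A × A) : antiDiag A (Prod.swap q) = (antiDiag A q)⁻¹ := by
  rw [antiDiag_apply, antiDiag_apply, Prod.fst_swap, Prod.snd_swap, inv_div]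

/-- The norms `q * swap q` of the pair lie in the diagonal — the hypothesis of `mk_map_eq_inv` for
`c = swap`, `H = diag`: the swap acts by inversion on the anticyclotomic quotient. -/
theorem mul_swap_mem_ker_antiDiag (q : A × A) : q * Prod.swap q ∈ (antiDiag A).ker := by
  rw [mem_ker_antiDiag_iff, Prod.fst_mul, Prod.snd_mul, Prod.fst_swap, Prod.snd_swap, mul_comm]

variable {M : Type*} [Group M]

/-- A character `ν ∘ antiDiag` of the anticyclotomic quotient satisfies `ψ (swap q) = (ψ q)⁻¹`. -/
theorem comp_antiDiag_swap (ν : A →* M) (q : A × A) :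
    (ν.comp (antiDiag A)) (Prod.swap q) = ((ν.comp (antiDiag A)) q)⁻¹ := by
  rw [MonoidHom.comp_apply, MonoidHom.comp_apply, antiDiag_swap, map_inv]

/-- `ν ∘ antiDiag` is trivial on `U × 1` (the units at `𝔓`) iff `ν` is trivial on `U`. -/
theorem prod_bot_le_ker_iff (ν : A →* M) (U : Subgroup A) :
    U.prod ⊥ ≤ (ν.comp (antiDiag A)).ker ↔ U ≤ ν.ker := by
  constructor
  · intro h u hu
    have h1 : (u, (1 : A)) ∈ U.prod ⊥ := Subgroup.mem_prod.mpr ⟨hu, Subgroup.mem_bot.mpr rfl⟩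
    have h2 := h h1
    rwa [MonoidHom.mem_ker, MonoidHom.comp_apply, antiDiag_apply, div_one] at h2
  · rintro h ⟨x, y⟩ hxy
    simp only [Subgroup.mem_prod, Subgroup.mem_bot] at hxy
    obtain ⟨hx, rfl⟩ := hxy
    rw [MonoidHom.mem_ker, MonoidHom.comp_apply, antiDiag_apply, div_one]
    exact h hx

/-- `ν ∘ antiDiag` is trivial on `1 × U` (the units at `𝔓̄`) iff `ν` is trivial on `U`. -/
theorem bot_prod_le_ker_iff (ν : A →* M) (U : Subgroup A) :
    (⊥ : Subgroup A).prod U ≤ (ν.comp (antiDiag A)).ker ↔ U ≤ ν.ker := by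
  constructor
  · intro h u hu
    have h1 : ((1 : A), u) ∈ (⊥ : Subgroup A).prod U :=
      Subgroup.mem_prod.mpr ⟨Subgroup.mem_bot.mpr rfl, hu⟩
    have h2 := h h1
    rwa [MonoidHom.mem_ker, MonoidHom.comp_apply, antiDiag_apply, one_div, map_inv, inv_eq_one]
      at h2
  · rintro h ⟨x, y⟩ hxy
    simp only [Subgroup.mem_prod, Subgroup.mem_bot] at hxy
    obtain ⟨rfl, hy⟩ := hxy
    rw [MonoidHom.mem_ker, MonoidHom.comp_apply, antiDiag_apply, one_div, map_inv, inv_eq_one]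
    exact h hy

/-- «the SAME exponent n at 𝔓 and 𝔓̄» on the pair: a character of the anticyclotomic quotient is
trivial on `U × 1` iff it is trivial on `1 × U`. -/
theorem prod_bot_le_ker_iff_bot_prod_le_ker (ν : A →* M) (U : Subgroup A) :
    U.prod ⊥ ≤ (ν.comp (antiDiag A)).ker ↔ (⊥ : Subgroup A).prod U ≤ (ν.comp (antiDiag A)).ker := by
  rw [prod_bot_le_ker_iff, bot_prod_le_ker_iff]

/-- For a filtration `U n` of the line (`1 + pⁿℤ_p`), the conductor exponent of `ν ∘ antiDiag`
at `𝔓` (levels `U n × 1`) equals the one at `𝔓̄` (levels `1 × U n`), both = the conductor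
exponent of `ν` on the line. -/
theorem sInf_prod_bot_le_ker_eq (ν : A →* M) (U : ℕ → Subgroup A) :
    sInf {n | (U n).prod ⊥ ≤ (ν.comp (antiDiag A)).ker} =
      sInf {n | (⊥ : Subgroup A).prod (U n) ≤ (ν.comp (antiDiag A)).ker} ∧
    sInf {n | (U n).prod ⊥ ≤ (ν.comp (antiDiag A)).ker} = sInf {n | U n ≤ ν.ker} := by
  have h1 : {n | (U n).prod ⊥ ≤ (ν.comp (antiDiag A)).ker} = {n | U n ≤ ν.ker} := by
    ext n
    exact prod_bot_le_ker_iff ν (U n)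
  have h2 : {n | (⊥ : Subgroup A).prod (U n) ≤ (ν.comp (antiDiag A)).ker} = {n | U n ≤ ν.ker} := by
    ext n
    exact bot_prod_le_ker_iff ν (U n)
  rw [h1, h2]
  exact ⟨rfl, rfl⟩

end AntiDiagonal

section Places

variable (A : Type*) [CommGroup A] (ι : Type*)

/-- The anticyclotomic map on the product over the places `𝔮 | p` of `E′⁺` of the pairs
`(1 + 𝔓_𝔮𝒪) × (1 + 𝔓̄_𝔮𝒪)`: coordinatewise `(x, y) ↦ x / y`. -/
def antiDiagPi : (ι → A × A) →* (ι → A) :=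
  MonoidHom.pi fun i => (antiDiag A).comp (Pi.evalMonoidHom (fun _ : ι => A × A) i)

variable {A ι}

/-- The defining formula. -/
@[simp] theorem antiDiagPi_apply (q : ι → A × A) (i : ι) :
    antiDiagPi A ι q i = (q i).1 / (q i).2 := rfl

/-- Its kernel is the product of the diagonals. -/
theorem mem_ker_antiDiagPi_iff (q : ι → A × A) :
    q ∈ (antiDiagPi A ι).ker ↔ ∀ i, (q i).1 = (q i).2 := by
  rw [MonoidHom.mem_ker, funext_iff]
  simp only [antiDiagPi_apply, Pi.one_apply, div_eq_one]

/-- It is surjective. -/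
theorem antiDiagPi_surjective : Function.Surjective (antiDiagPi A ι) := fun x =>
  ⟨fun i => (x i, 1), by
    ext i
    simp⟩

/-- «The anticyclotomic quotient of U¹ is ⊕_{𝔮 | p} ℤ_p e_𝔮»: the quotient of the product of the
pairs by the product of the diagonals is the product of the lines. -/
noncomputable def antiDiagPiQuotientEquiv :
    (ι → A × A) ⧸ (antiDiagPi A ι).ker ≃* (ι → A) :=
  QuotientGroup.quotientKerEquivOfSurjective (antiDiagPi A ι) antiDiagPi_surjective

end Places

end Summit.Ventures.HodgeRepro.T3.AnticyclotomicInvolution
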